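import Summits.BirchSwinnertonDyer.BirchSwinnertonDyer.Theorems.KatoDescentPotSupersingularWildUpperMuRoadThreeFukudaRecords12
import Literature.NumberTheory.IwasawaTheory.Fukuda1994Thm1RankProofs
import Literature.NumberTheory.IwasawaTheory.Fukuda1994Thm1Proofs
import HarnessLib

/-!
# K9 records of `WildUpperMuRoadThreeFukudaRecords12` with Fukuda's Theorem 1 (2) DISCHARGED (hF2-free re-issue)

Written by the prover seat `bsd-potss-k8t-c4` g20 (cell `bsd-potss`; courtesy for the K9 record lane of k9-c4,
`--supports stmt-BirchSwinnertonDyer-19197 --as helper`; closes nothing; BSD claimed for no curve). Every record of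
`Theorems/KatoDescentPotSupersingularWildUpperMuRoadThreeFukudaRecords12.lean` that displayed the named-fact hypothesis `hF2 : fukuda1994_thm1_classGroupPRank_const_of_succ_eq`
(Fukuda 1994 Thm. 1 (2), `p`-ranks) is re-issued WITHOUT it (suffix `F2`, one application of the tree theorem
`Literature.NumberTheory.IwasawaTheory.fukuda1994_thm1_classGroupPRank_const_of_succ_eq_holds`, `Fukuda1994Thm1RankProofs.lean`, k8t-c4 g20;
where a record also displayed `hF1`, Fukuda Thm. 1 (1), it is discharged too by g19's `fukuda1994_thm1_classNumberPExp_const_of_succ_eq_holds`).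
All other displayed named facts (`hCS`, `hI`, `hFW`, `hKatoA`, `hGZK`, `hmod`, …) and row data (`hWeq`, `hr`, `c`, `hrk`/`hord`) are untouched;
statements are those of the source records verbatim minus the Fukuda binders.
-/

set_option autoImplicit false
set_option linter.dupNamespace false

noncomputable section

open scoped Classical NumberField
open WeierstrassCurve Field IntermediateField IsDedekindDomain
  Literature.NumberTheory.EllipticCurves Literature.NumberTheory.EllipticCurves.Rank1Residual
  Literature.NumberTheory.EllipticCurves.Rank1Residual.Typed
  Literature.NumberTheory.GaloisRepresentations Literature.NumberTheory.SerreUniformity Literature.NumberTheory.IwasawaTheory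
  Summit.BirchSwinnertonDyer.Rank1Residual Summit.BirchSwinnertonDyer.Rank1Residual.Additive
  Summit.BirchSwinnertonDyer.BirchSwinnertonDyer.Theorems
namespace Summit.BirchSwinnertonDyer.BirchSwinnertonDyer.Theorems.WildUpperUnitTwistRecords

/-- **(A) AT `(475200ea1, 3)` FROM TWO NAMED FACTS + ONE `3`-RANK EQUALITY ON `L = ℚ(E[3])`**: `hCS` (Coates–Sujatha 3.4), `hF2` (Fukuda Thm. 1 (2)); KERNEL `irr_g475200ea1_3`,
`notOntoThree_g475200ea1` (⟹ Fukuda index `0`); DISPLAYED `hrk : r₁(L) = r₀(L)` (numerically `2 = 2`, Kuroda's `3`-torsion relation from conjA's class groups, GRH).  Per row;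
CONDITIONAL; (A) not asserted; nothing booked. [cite: Fukuda1994, Thm. 1 (2), p. 264] [cite: CoatesSujatha2005, Thm. 3.4 (§3)] [cite: Serre1972, §2.4 Prop. 15] [cite: Cremona2006, Table 1 (Cremona label 475200ea1)]
hF2-FREE re-issue of `conjA_g475200ea1_3_fkL01r` (Fukuda 1994 Thm. 1 (2) is the tree theorem
`fukuda1994_thm1_classGroupPRank_const_of_succ_eq_holds`). -/
theorem conjA_g475200ea1_3_fkL01rF2
    (hCS : CoatesSujatha2005.thm34_fineSelmerDual_moduleFinite_of_classicalMuVanishes_divisionField)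
    {W : WeierstrassCurve ℚ} [W.IsElliptic] (hWeq : W = (⟨0, 0, 0, (-87750), (-9618750)⟩ : WeierstrassCurve ℚ))
    (hrk : ∀ κL : ZpExtension ↥(W.divisionField 3) 3, κL.IsCyclotomic → classGroupPRank κL (0 + 1) = classGroupPRank κL 0)
    (κ : ZpExtension ℚ 3) (hκ : κ.IsCyclotomic) :
    ∃ (γ : absoluteGaloisGroup ℚ) (Df : W.FineSelmerDualData κ γ),
      Module.Finite ℤ_[3] (RestrictScalars ℤ_[3] (IwasawaAlgebra 3) Df.X) := by
  apply conjA_g475200ea1_3_fkL01r <;>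
    first
    | exact Literature.NumberTheory.IwasawaTheory.fukuda1994_thm1_classGroupPRank_const_of_succ_eq_holds
    | exact Literature.NumberTheory.IwasawaTheory.fukuda1994_thm1_classNumberPExp_const_of_succ_eq_holds
    | assumption

/-- **RECORD (second road, on `L = ℚ(E[3])`) — UPPER half `ord₃ #Ш(E) ≤ ord₃ #Ш(E)_an` for `E = 475200ea1` at `p = 3` FROM ONE FUKUDA `3`-RANK EQUALITY `r₁(L) = r₀(L)`**
(U₀-ns row of K9 items 19189 / 19197; door `DivisionFieldFukudaDoor.missingUpperBoundAt_three_of_notSurj_of_classGroupPRank_succ_eq` = fine-Selmer port of Kato 14.5 (3) ∘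
Coates–Sujatha 3.4 ∘ Fukuda Thm. 1 (2), Fukuda's index put in the kernel by Serre Prop. 15).  KERNEL (imported / above): `Δ ≠ 0`, minimality, `irr_g475200ea1_3`,
`classO6_g475200ea1_3`, `notOntoThree_g475200ea1`.  DISPLAYED: named facts `hKatoA hGZK hmod hCS hF2`; Cremona's `r_an = 0` (`hr`); `hrk : r₁(L) = r₀(L)` (`= 2`; Kuroda's
`3`-torsion relation from conjA-anchor g8's class groups, GRH).  Per row; CONDITIONAL; nothing booked; BSD is not proved by this. [cite: Kato2004Asterisque, Thm. 14.5 (3) (p. 236)]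
[cite: Fukuda1994, Thm. 1 (2), p. 264] [cite: CoatesSujatha2005, Thm. 3.4 (§3)] [cite: Serre1972, §2.4 Prop. 15] [cite: Cremona2006, Table 1 (Cremona label 475200ea1)]
hF2-FREE re-issue of `missingUpperBoundAt_g475200ea1_3_fkL01r` (Fukuda 1994 Thm. 1 (2) is the tree theorem
`fukuda1994_thm1_classGroupPRank_const_of_succ_eq_holds`). -/
theorem missingUpperBoundAt_g475200ea1_3_fkL01rF2
    (hKatoA : Kato2004.rankZero_padicValNat_sha_add_padicValNat_tamagawa_le_of_additive_potGood_of_irreducible_of_fineSelmerDual_fg)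
    (hGZK : rank_eq_analyticRank_of_analyticRank_le_one) (hmod : hasEntireLFunction_rat)
    (hCS : CoatesSujatha2005.thm34_fineSelmerDual_moduleFinite_of_classicalMuVanishes_divisionField)
    {W : WeierstrassCurve ℚ} [W.IsElliptic] [W.IsGloballyMinimal] (hWeq : W = (⟨0, 0, 0, (-87750), (-9618750)⟩ : WeierstrassCurve ℚ)) (hr : W.analyticRank = 0)
    (hrk : ∀ κL : ZpExtension ↥(W.divisionField 3) 3, κL.IsCyclotomic → classGroupPRank κL (0 + 1) = classGroupPRank κL 0) :
    MissingUpperBoundAt W 3 := by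
  apply missingUpperBoundAt_g475200ea1_3_fkL01r <;>
    first
    | exact Literature.NumberTheory.IwasawaTheory.fukuda1994_thm1_classGroupPRank_const_of_succ_eq_holds
    | exact Literature.NumberTheory.IwasawaTheory.fukuda1994_thm1_classNumberPExp_const_of_succ_eq_holds
    | assumption

/-- **(A) AT `(475200tc1, 3)` FROM TWO NAMED FACTS + ONE `3`-RANK EQUALITY ON `L = ℚ(E[3])`**: `hCS` (Coates–Sujatha 3.4), `hF2` (Fukuda Thm. 1 (2)); KERNEL `irr_g475200tc1_3`,
`notOntoThree_g475200tc1` (⟹ Fukuda index `0`); DISPLAYED `hrk : r₁(L) = r₀(L)` (numerically `2 = 2`, Kuroda's `3`-torsion relation from conjA's class groups, GRH).  Per row;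
CONDITIONAL; (A) not asserted; nothing booked. [cite: Fukuda1994, Thm. 1 (2), p. 264] [cite: CoatesSujatha2005, Thm. 3.4 (§3)] [cite: Serre1972, §2.4 Prop. 15] [cite: Cremona2006, Table 1 (Cremona label 475200tc1)]
hF2-FREE re-issue of `conjA_g475200tc1_3_fkL01r` (Fukuda 1994 Thm. 1 (2) is the tree theorem
`fukuda1994_thm1_classGroupPRank_const_of_succ_eq_holds`). -/
theorem conjA_g475200tc1_3_fkL01rF2
    (hCS : CoatesSujatha2005.thm34_fineSelmerDual_moduleFinite_of_classicalMuVanishes_divisionField)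
    {W : WeierstrassCurve ℚ} [W.IsElliptic] (hWeq : W = (⟨0, 0, 0, (-9750), (-356250)⟩ : WeierstrassCurve ℚ))
    (hrk : ∀ κL : ZpExtension ↥(W.divisionField 3) 3, κL.IsCyclotomic → classGroupPRank κL (0 + 1) = classGroupPRank κL 0)
    (κ : ZpExtension ℚ 3) (hκ : κ.IsCyclotomic) :
    ∃ (γ : absoluteGaloisGroup ℚ) (Df : W.FineSelmerDualData κ γ),
      Module.Finite ℤ_[3] (RestrictScalars ℤ_[3] (IwasawaAlgebra 3) Df.X) := by
  apply conjA_g475200tc1_3_fkL01r <;>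
    first
    | exact Literature.NumberTheory.IwasawaTheory.fukuda1994_thm1_classGroupPRank_const_of_succ_eq_holds
    | exact Literature.NumberTheory.IwasawaTheory.fukuda1994_thm1_classNumberPExp_const_of_succ_eq_holds
    | assumption

/-- **RECORD (second road, on `L = ℚ(E[3])`) — UPPER half `ord₃ #Ш(E) ≤ ord₃ #Ш(E)_an` for `E = 475200tc1` at `p = 3` FROM ONE FUKUDA `3`-RANK EQUALITY `r₁(L) = r₀(L)`**
(U₀-ns row of K9 items 19189 / 19197; door `DivisionFieldFukudaDoor.missingUpperBoundAt_three_of_notSurj_of_classGroupPRank_succ_eq` = fine-Selmer port of Kato 14.5 (3) ∘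
Coates–Sujatha 3.4 ∘ Fukuda Thm. 1 (2), Fukuda's index put in the kernel by Serre Prop. 15).  KERNEL (imported / above): `Δ ≠ 0`, minimality, `irr_g475200tc1_3`,
`classO6_g475200tc1_3`, `notOntoThree_g475200tc1`.  DISPLAYED: named facts `hKatoA hGZK hmod hCS hF2`; Cremona's `r_an = 0` (`hr`); `hrk : r₁(L) = r₀(L)` (`= 2`; Kuroda's
`3`-torsion relation from conjA-anchor g8's class groups, GRH).  Per row; CONDITIONAL; nothing booked; BSD is not proved by this. [cite: Kato2004Asterisque, Thm. 14.5 (3) (p. 236)]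
[cite: Fukuda1994, Thm. 1 (2), p. 264] [cite: CoatesSujatha2005, Thm. 3.4 (§3)] [cite: Serre1972, §2.4 Prop. 15] [cite: Cremona2006, Table 1 (Cremona label 475200tc1)]
hF2-FREE re-issue of `missingUpperBoundAt_g475200tc1_3_fkL01r` (Fukuda 1994 Thm. 1 (2) is the tree theorem
`fukuda1994_thm1_classGroupPRank_const_of_succ_eq_holds`). -/
theorem missingUpperBoundAt_g475200tc1_3_fkL01rF2
    (hKatoA : Kato2004.rankZero_padicValNat_sha_add_padicValNat_tamagawa_le_of_additive_potGood_of_irreducible_of_fineSelmerDual_fg)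
    (hGZK : rank_eq_analyticRank_of_analyticRank_le_one) (hmod : hasEntireLFunction_rat)
    (hCS : CoatesSujatha2005.thm34_fineSelmerDual_moduleFinite_of_classicalMuVanishes_divisionField)
    {W : WeierstrassCurve ℚ} [W.IsElliptic] [W.IsGloballyMinimal] (hWeq : W = (⟨0, 0, 0, (-9750), (-356250)⟩ : WeierstrassCurve ℚ)) (hr : W.analyticRank = 0)
    (hrk : ∀ κL : ZpExtension ↥(W.divisionField 3) 3, κL.IsCyclotomic → classGroupPRank κL (0 + 1) = classGroupPRank κL 0) :
    MissingUpperBoundAt W 3 := by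
  apply missingUpperBoundAt_g475200tc1_3_fkL01r <;>
    first
    | exact Literature.NumberTheory.IwasawaTheory.fukuda1994_thm1_classGroupPRank_const_of_succ_eq_holds
    | exact Literature.NumberTheory.IwasawaTheory.fukuda1994_thm1_classNumberPExp_const_of_succ_eq_holds
    | assumption

/-- **(A) AT `(487350bv1, 3)` FROM TWO NAMED FACTS + ONE `3`-RANK EQUALITY ON `L = ℚ(E[3])`**: `hCS` (Coates–Sujatha 3.4), `hF2` (Fukuda Thm. 1 (2)); KERNEL `irr_g487350bv1_3`,
`notOntoThree_g487350bv1` (⟹ Fukuda index `0`); DISPLAYED `hrk : r₁(L) = r₀(L)` (numerically `2 = 2`, Kuroda's `3`-torsion relation from conjA's class groups, GRH).  Per row;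
CONDITIONAL; (A) not asserted; nothing booked. [cite: Fukuda1994, Thm. 1 (2), p. 264] [cite: CoatesSujatha2005, Thm. 3.4 (§3)] [cite: Serre1972, §2.4 Prop. 15] [cite: Cremona2006, Table 1 (Cremona label 487350bv1)]
hF2-FREE re-issue of `conjA_g487350bv1_3_fkL01r` (Fukuda 1994 Thm. 1 (2) is the tree theorem
`fukuda1994_thm1_classGroupPRank_const_of_succ_eq_holds`). -/
theorem conjA_g487350bv1_3_fkL01rF2
    (hCS : CoatesSujatha2005.thm34_fineSelmerDual_moduleFinite_of_classicalMuVanishes_divisionField)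
    {W : WeierstrassCurve ℚ} [W.IsElliptic] (hWeq : W = (⟨1, (-1), 0, 2835768, 2036269376⟩ : WeierstrassCurve ℚ))
    (hrk : ∀ κL : ZpExtension ↥(W.divisionField 3) 3, κL.IsCyclotomic → classGroupPRank κL (0 + 1) = classGroupPRank κL 0)
    (κ : ZpExtension ℚ 3) (hκ : κ.IsCyclotomic) :
    ∃ (γ : absoluteGaloisGroup ℚ) (Df : W.FineSelmerDualData κ γ),
      Module.Finite ℤ_[3] (RestrictScalars ℤ_[3] (IwasawaAlgebra 3) Df.X) := by
  apply conjA_g487350bv1_3_fkL01r <;>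
    first
    | exact Literature.NumberTheory.IwasawaTheory.fukuda1994_thm1_classGroupPRank_const_of_succ_eq_holds
    | exact Literature.NumberTheory.IwasawaTheory.fukuda1994_thm1_classNumberPExp_const_of_succ_eq_holds
    | assumption

/-- **RECORD (second road, on `L = ℚ(E[3])`) — UPPER half `ord₃ #Ш(E) ≤ ord₃ #Ш(E)_an` for `E = 487350bv1` at `p = 3` FROM ONE FUKUDA `3`-RANK EQUALITY `r₁(L) = r₀(L)`**
(U₀-ns row of K9 items 19189 / 19197; door `DivisionFieldFukudaDoor.missingUpperBoundAt_three_of_notSurj_of_classGroupPRank_succ_eq` = fine-Selmer port of Kato 14.5 (3) ∘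
Coates–Sujatha 3.4 ∘ Fukuda Thm. 1 (2), Fukuda's index put in the kernel by Serre Prop. 15).  KERNEL (imported / above): `Δ ≠ 0`, minimality, `irr_g487350bv1_3`,
`classO6_g487350bv1_3`, `notOntoThree_g487350bv1`.  DISPLAYED: named facts `hKatoA hGZK hmod hCS hF2`; Cremona's `r_an = 0` (`hr`); `hrk : r₁(L) = r₀(L)` (`= 2`; Kuroda's
`3`-torsion relation from conjA-anchor g8's class groups, GRH).  Per row; CONDITIONAL; nothing booked; BSD is not proved by this. [cite: Kato2004Asterisque, Thm. 14.5 (3) (p. 236)]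
[cite: Fukuda1994, Thm. 1 (2), p. 264] [cite: CoatesSujatha2005, Thm. 3.4 (§3)] [cite: Serre1972, §2.4 Prop. 15] [cite: Cremona2006, Table 1 (Cremona label 487350bv1)]
hF2-FREE re-issue of `missingUpperBoundAt_g487350bv1_3_fkL01r` (Fukuda 1994 Thm. 1 (2) is the tree theorem
`fukuda1994_thm1_classGroupPRank_const_of_succ_eq_holds`). -/
theorem missingUpperBoundAt_g487350bv1_3_fkL01rF2
    (hKatoA : Kato2004.rankZero_padicValNat_sha_add_padicValNat_tamagawa_le_of_additive_potGood_of_irreducible_of_fineSelmerDual_fg)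
    (hGZK : rank_eq_analyticRank_of_analyticRank_le_one) (hmod : hasEntireLFunction_rat)
    (hCS : CoatesSujatha2005.thm34_fineSelmerDual_moduleFinite_of_classicalMuVanishes_divisionField)
    {W : WeierstrassCurve ℚ} [W.IsElliptic] [W.IsGloballyMinimal] (hWeq : W = (⟨1, (-1), 0, 2835768, 2036269376⟩ : WeierstrassCurve ℚ)) (hr : W.analyticRank = 0)
    (hrk : ∀ κL : ZpExtension ↥(W.divisionField 3) 3, κL.IsCyclotomic → classGroupPRank κL (0 + 1) = classGroupPRank κL 0) :
    MissingUpperBoundAt W 3 := by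
  apply missingUpperBoundAt_g487350bv1_3_fkL01r <;>
    first
    | exact Literature.NumberTheory.IwasawaTheory.fukuda1994_thm1_classGroupPRank_const_of_succ_eq_holds
    | exact Literature.NumberTheory.IwasawaTheory.fukuda1994_thm1_classNumberPExp_const_of_succ_eq_holds
    | assumption

/-- **(A) AT `(487350fs1, 3)` FROM TWO NAMED FACTS + ONE `3`-RANK EQUALITY ON `L = ℚ(E[3])`**: `hCS` (Coates–Sujatha 3.4), `hF2` (Fukuda Thm. 1 (2)); KERNEL `irr_g487350fs1_3`,
`notOntoThree_g487350fs1` (⟹ Fukuda index `0`); DISPLAYED `hrk : r₁(L) = r₀(L)` (numerically `2 = 2`, Kuroda's `3`-torsion relation from conjA's class groups, GRH).  Per row;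
CONDITIONAL; (A) not asserted; nothing booked. [cite: Fukuda1994, Thm. 1 (2), p. 264] [cite: CoatesSujatha2005, Thm. 3.4 (§3)] [cite: Serre1972, §2.4 Prop. 15] [cite: Cremona2006, Table 1 (Cremona label 487350fs1)]
hF2-FREE re-issue of `conjA_g487350fs1_3_fkL01r` (Fukuda 1994 Thm. 1 (2) is the tree theorem
`fukuda1994_thm1_classGroupPRank_const_of_succ_eq_holds`). -/
theorem conjA_g487350fs1_3_fkL01rF2
    (hCS : CoatesSujatha2005.thm34_fineSelmerDual_moduleFinite_of_classicalMuVanishes_divisionField)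
    {W : WeierstrassCurve ℚ} [W.IsElliptic] (hWeq : W = (⟨1, (-1), 1, 315085, (-75522413)⟩ : WeierstrassCurve ℚ))
    (hrk : ∀ κL : ZpExtension ↥(W.divisionField 3) 3, κL.IsCyclotomic → classGroupPRank κL (0 + 1) = classGroupPRank κL 0)
    (κ : ZpExtension ℚ 3) (hκ : κ.IsCyclotomic) :
    ∃ (γ : absoluteGaloisGroup ℚ) (Df : W.FineSelmerDualData κ γ),
      Module.Finite ℤ_[3] (RestrictScalars ℤ_[3] (IwasawaAlgebra 3) Df.X) := by
  apply conjA_g487350fs1_3_fkL01r <;>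
    first
    | exact Literature.NumberTheory.IwasawaTheory.fukuda1994_thm1_classGroupPRank_const_of_succ_eq_holds
    | exact Literature.NumberTheory.IwasawaTheory.fukuda1994_thm1_classNumberPExp_const_of_succ_eq_holds
    | assumption

/-- **RECORD (second road, on `L = ℚ(E[3])`) — UPPER half `ord₃ #Ш(E) ≤ ord₃ #Ш(E)_an` for `E = 487350fs1` at `p = 3` FROM ONE FUKUDA `3`-RANK EQUALITY `r₁(L) = r₀(L)`**
(U₀-ns row of K9 items 19189 / 19197; door `DivisionFieldFukudaDoor.missingUpperBoundAt_three_of_notSurj_of_classGroupPRank_succ_eq` = fine-Selmer port of Kato 14.5 (3) ∘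
Coates–Sujatha 3.4 ∘ Fukuda Thm. 1 (2), Fukuda's index put in the kernel by Serre Prop. 15).  KERNEL (imported / above): `Δ ≠ 0`, minimality, `irr_g487350fs1_3`,
`classO6_g487350fs1_3`, `notOntoThree_g487350fs1`.  DISPLAYED: named facts `hKatoA hGZK hmod hCS hF2`; Cremona's `r_an = 0` (`hr`); `hrk : r₁(L) = r₀(L)` (`= 2`; Kuroda's
`3`-torsion relation from conjA-anchor g8's class groups, GRH).  Per row; CONDITIONAL; nothing booked; BSD is not proved by this. [cite: Kato2004Asterisque, Thm. 14.5 (3) (p. 236)]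
[cite: Fukuda1994, Thm. 1 (2), p. 264] [cite: CoatesSujatha2005, Thm. 3.4 (§3)] [cite: Serre1972, §2.4 Prop. 15] [cite: Cremona2006, Table 1 (Cremona label 487350fs1)]
hF2-FREE re-issue of `missingUpperBoundAt_g487350fs1_3_fkL01r` (Fukuda 1994 Thm. 1 (2) is the tree theorem
`fukuda1994_thm1_classGroupPRank_const_of_succ_eq_holds`). -/
theorem missingUpperBoundAt_g487350fs1_3_fkL01rF2
    (hKatoA : Kato2004.rankZero_padicValNat_sha_add_padicValNat_tamagawa_le_of_additive_potGood_of_irreducible_of_fineSelmerDual_fg)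
    (hGZK : rank_eq_analyticRank_of_analyticRank_le_one) (hmod : hasEntireLFunction_rat)
    (hCS : CoatesSujatha2005.thm34_fineSelmerDual_moduleFinite_of_classicalMuVanishes_divisionField)
    {W : WeierstrassCurve ℚ} [W.IsElliptic] [W.IsGloballyMinimal] (hWeq : W = (⟨1, (-1), 1, 315085, (-75522413)⟩ : WeierstrassCurve ℚ)) (hr : W.analyticRank = 0)
    (hrk : ∀ κL : ZpExtension ↥(W.divisionField 3) 3, κL.IsCyclotomic → classGroupPRank κL (0 + 1) = classGroupPRank κL 0) :
    MissingUpperBoundAt W 3 := by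
  apply missingUpperBoundAt_g487350fs1_3_fkL01r <;>
    first
    | exact Literature.NumberTheory.IwasawaTheory.fukuda1994_thm1_classGroupPRank_const_of_succ_eq_holds
    | exact Literature.NumberTheory.IwasawaTheory.fukuda1994_thm1_classNumberPExp_const_of_succ_eq_holds
    | assumption

/-- **(A) AT `(487350fv1, 3)` FROM TWO NAMED FACTS + ONE `3`-RANK EQUALITY ON `L = ℚ(E[3])`**: `hCS` (Coates–Sujatha 3.4), `hF2` (Fukuda Thm. 1 (2)); KERNEL `irr_g487350fv1_3`,
`notOntoThree_g487350fv1` (⟹ Fukuda index `0`); DISPLAYED `hrk : r₁(L) = r₀(L)` (numerically `2 = 2`, Kuroda's `3`-torsion relation from conjA's class groups, GRH).  Per row;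
CONDITIONAL; (A) not asserted; nothing booked. [cite: Fukuda1994, Thm. 1 (2), p. 264] [cite: CoatesSujatha2005, Thm. 3.4 (§3)] [cite: Serre1972, §2.4 Prop. 15] [cite: Cremona2006, Table 1 (Cremona label 487350fv1)]
hF2-FREE re-issue of `conjA_g487350fv1_3_fkL01r` (Fukuda 1994 Thm. 1 (2) is the tree theorem
`fukuda1994_thm1_classGroupPRank_const_of_succ_eq_holds`). -/
theorem conjA_g487350fv1_3_fkL01rF2
    (hCS : CoatesSujatha2005.thm34_fineSelmerDual_moduleFinite_of_classicalMuVanishes_divisionField)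
    {W : WeierstrassCurve ℚ} [W.IsElliptic] (hWeq : W = (⟨1, (-1), 1, (-1125305), (-725138303)⟩ : WeierstrassCurve ℚ))
    (hrk : ∀ κL : ZpExtension ↥(W.divisionField 3) 3, κL.IsCyclotomic → classGroupPRank κL (0 + 1) = classGroupPRank κL 0)
    (κ : ZpExtension ℚ 3) (hκ : κ.IsCyclotomic) :
    ∃ (γ : absoluteGaloisGroup ℚ) (Df : W.FineSelmerDualData κ γ),
      Module.Finite ℤ_[3] (RestrictScalars ℤ_[3] (IwasawaAlgebra 3) Df.X) := by
  apply conjA_g487350fv1_3_fkL01r <;>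
    first
    | exact Literature.NumberTheory.IwasawaTheory.fukuda1994_thm1_classGroupPRank_const_of_succ_eq_holds
    | exact Literature.NumberTheory.IwasawaTheory.fukuda1994_thm1_classNumberPExp_const_of_succ_eq_holds
    | assumption

/-- **RECORD (second road, on `L = ℚ(E[3])`) — UPPER half `ord₃ #Ш(E) ≤ ord₃ #Ш(E)_an` for `E = 487350fv1` at `p = 3` FROM ONE FUKUDA `3`-RANK EQUALITY `r₁(L) = r₀(L)`**
(U₀-ns row of K9 items 19189 / 19197; door `DivisionFieldFukudaDoor.missingUpperBoundAt_three_of_notSurj_of_classGroupPRank_succ_eq` = fine-Selmer port of Kato 14.5 (3) ∘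
Coates–Sujatha 3.4 ∘ Fukuda Thm. 1 (2), Fukuda's index put in the kernel by Serre Prop. 15).  KERNEL (imported / above): `Δ ≠ 0`, minimality, `irr_g487350fv1_3`,
`classO6_g487350fv1_3`, `notOntoThree_g487350fv1`.  DISPLAYED: named facts `hKatoA hGZK hmod hCS hF2`; Cremona's `r_an = 0` (`hr`); `hrk : r₁(L) = r₀(L)` (`= 2`; Kuroda's
`3`-torsion relation from conjA-anchor g8's class groups, GRH).  Per row; CONDITIONAL; nothing booked; BSD is not proved by this. [cite: Kato2004Asterisque, Thm. 14.5 (3) (p. 236)]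
[cite: Fukuda1994, Thm. 1 (2), p. 264] [cite: CoatesSujatha2005, Thm. 3.4 (§3)] [cite: Serre1972, §2.4 Prop. 15] [cite: Cremona2006, Table 1 (Cremona label 487350fv1)]
hF2-FREE re-issue of `missingUpperBoundAt_g487350fv1_3_fkL01r` (Fukuda 1994 Thm. 1 (2) is the tree theorem
`fukuda1994_thm1_classGroupPRank_const_of_succ_eq_holds`). -/
theorem missingUpperBoundAt_g487350fv1_3_fkL01rF2
    (hKatoA : Kato2004.rankZero_padicValNat_sha_add_padicValNat_tamagawa_le_of_additive_potGood_of_irreducible_of_fineSelmerDual_fg)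
    (hGZK : rank_eq_analyticRank_of_analyticRank_le_one) (hmod : hasEntireLFunction_rat)
    (hCS : CoatesSujatha2005.thm34_fineSelmerDual_moduleFinite_of_classicalMuVanishes_divisionField)
    {W : WeierstrassCurve ℚ} [W.IsElliptic] [W.IsGloballyMinimal] (hWeq : W = (⟨1, (-1), 1, (-1125305), (-725138303)⟩ : WeierstrassCurve ℚ)) (hr : W.analyticRank = 0)
    (hrk : ∀ κL : ZpExtension ↥(W.divisionField 3) 3, κL.IsCyclotomic → classGroupPRank κL (0 + 1) = classGroupPRank κL 0) :
    MissingUpperBoundAt W 3 := by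
  apply missingUpperBoundAt_g487350fv1_3_fkL01r <;>
    first
    | exact Literature.NumberTheory.IwasawaTheory.fukuda1994_thm1_classGroupPRank_const_of_succ_eq_holds
    | exact Literature.NumberTheory.IwasawaTheory.fukuda1994_thm1_classNumberPExp_const_of_succ_eq_holds
    | assumption

end Summit.BirchSwinnertonDyer.BirchSwinnertonDyer.Theorems.WildUpperUnitTwistRecords

end
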